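import Summits.AtomisticToContinuum.FouriersLaw.Theorems.BondHeatUncertaintyExtensiveSnapshotIrreversibilityEnergyWindowExcessFilter
import Summits.AtomisticToContinuum.FouriersLaw.Theorems.BondHeatUncertaintyExtensiveSnapshotIrreversibilityEnergyWindowTriangularLower
import Summits.AtomisticToContinuum.FouriersLaw.Theorems.BondHeatUncertaintyExtensiveSnapshotIrreversibilityEnergyWindowDivergenceAtoms

/-!
# Crux `ExtensiveSnapshotIrreversibility` (stmt-AtomisticToContinuum-9121), fixed-`N` half `K_fix`:
`K_fix ⟺ ΔSharp ∧ USharp` — the tail input is ONE atom, and it is NECESSARY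
(node «UniformIntegrabilityLadder»; statement + glue file)

(statement + glue file, theorem-side; decomp-a2c lens-1 «grading / quantitative ladder», gen 90.)

Generation 89 reached `K_fix ⟸ A0 ∧ A2ₚ ∧ SPC ∧ ΔSharp` with ΔSharp NECESSARY and the pair
(A2ₚ, SPC) — a moment bound and a superpolynomial concentration of the odd log-ratio
`ψ_δ = log dμ_δ/dΘ_*μ_δ` — as the remaining, individually unnecessary, tail inputs.  Grading the
tail by the quantity the seam actually consumes closes the gap:

* USharp `NessOddLogRatioUniformlyIntegrable` — at the item's own `h` (VERBATIM the hypothesis of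
  `K_fix`, as for ΔSharp): for every level `η > 0` and every `ε > 0`, eventually in `δ ≠ 0`, for
  every measurable `φ` with `μ_δ = μ_T · e^{φ}`: `∫_{|ψ|>η} |ψ| dμ_δ ≤ ε δ²` (`ψ = φ − φ∘Θ`;
  written as `∫_{|ψ|>η} |ψ| e^{φ} dμ_T`) — UNIFORM INTEGRABILITY OF THE ODD LOG-RATIO AT SCALE `δ²`.

* ★★ `snapshotKLUpperExpansion_of_uniformlyIntegrable` — THE JUNCTION `K_fix ⟸ A0 ∧ USharp ∧ ΔSharp`
  (`…ExcessFilter.klDiv_flip_le_of_uniformlyIntegrable`);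
* ★★ `nessOddLogRatioUniformlyIntegrable_of_snapshotKLUpperExpansion` — NECESSITY
  `K_fix ⟹ USharp`, NO atom: `K_fix` bounds `KL ≤ (K₀+θ) δ²`, the THEOREM ΔLower
  (`…TriangularLower.nessFlipTriangularLower_holds`) bounds `Δ ≥ (K₀−θ) δ²`, and the excess
  `KL − Δ` dominates `2 · excessSlope η ·` tail
  (`…ExcessFilter.setIntegral_abs_mul_exp_le_of_klDiv_le`);
* ★★★ `snapshotKLUpperExpansion_iff` — `A0 ⊢ (K_fix ⟺ ΔSharp ∧ USharp)`: the crux's fixed-`N`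
  half is EXACTLY the conjunction of two sharp second-order atoms, one in the bulk (triangular
  discrimination `≤ K δ²`) and one in the tail (uniform integrability at scale `δ²`); every other
  tail atom of the lineage (A2ₚ, SPC, W3, window smallness, moment decay) is a RUNG feeding USharp
  (`…ExcessRungs`), and A0 is a theorem of the tree (`ClausiusBudget.LogDensity`).

No new objects. [folklore]
-/

noncomputable section

namespace Summit.AtomisticToContinuum.FouriersLaw.Theorems.ExtensiveSnapshotIrreversibility.EnergyWindow

open MeasureTheory Filter Topology InformationTheory Real
open scoped ENNReal NNReal
open Literature.MathematicalPhysics.KineticTheory.HeatConduction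
open Summit.AtomisticToContinuum.FouriersLaw.Theorems.ExtensiveSnapshotIrreversibility.Negative
open Summit.AtomisticToContinuum.FouriersLaw.Theorems.ExtensiveSnapshotIrreversibility.ClausiusBudget.OddLogDensity

variable {N : ℕ}

/-! ## 1. The atom USharp -/

/-- **USharp `NessOddLogRatioUniformlyIntegrable` (uniform integrability of the odd log-ratio at
scale `δ²`)**: along every steady-state family of the pinned chain (under weak-NESS uniqueness),
for `T > 0`, `N ≥ 2`, every `L²` linear-response density `h` at `δ = 0` (VERBATIM the hypothesis
of `K_fix`), every level `η > 0` and every `ε > 0`: eventually in `δ ≠ 0`, for EVERY measurable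
`φ` with `μ_{N,T+δ/2,T−δ/2} = μ_T · e^{φ}`, the odd log-ratio `ψ = φ − φ∘Θ = log dμ_δ/dΘ_*μ_δ`
satisfies `|ψ| e^{φ} ∈ L¹(μ_T)` (i.e. `ψ ∈ L¹(μ_δ)`) and
`∫_{|ψ|>η} |ψ| e^{φ} dμ_T = ∫_{|ψ|>η} |ψ| dμ_δ ≤ ε δ²`.  Intrinsic in the pair `(μ_δ, Θ_*μ_δ)`;
NECESSARY for `K_fix` (`nessOddLogRatioUniformlyIntegrable_of_snapshotKLUpperExpansion`) and, with
ΔSharp and A0, SUFFICIENT (`snapshotKLUpperExpansion_of_uniformlyIntegrable`).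
[route statement · this cell; NOT a literature fact] -/
def NessOddLogRatioUniformlyIntegrable : Prop :=
  ∀ ω₂ lam β γ : ℝ, 0 < ω₂ → 0 < lam → 0 < β → 0 < γ →
    (∀ (N : ℕ) (T_L T_R : ℝ), 0 < T_L → 0 < T_R → ∀ μ ν : Measure (PhaseSpace N),
      (pinnedChain ω₂ lam β γ).IsSteadyState N T_L T_R μ →
      (pinnedChain ω₂ lam β γ).IsSteadyState N T_L T_R ν → μ = ν) →
    ∀ μ : (N : ℕ) → ℝ → ℝ → Measure (PhaseSpace N),
      (∀ (N : ℕ) (T_L T_R : ℝ), 0 < T_L → 0 < T_R →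
        (pinnedChain ω₂ lam β γ).IsSteadyState N T_L T_R (μ N T_L T_R)) →
      ∀ T : ℝ, 0 < T → ∀ N : ℕ, 2 ≤ N → ∀ h : PhaseSpace N → ℝ,
        (MemLp h 2 (μ N T T) ∧
          (∀ F : PhaseSpace N → ℝ, ContDiff ℝ ((⊤ : ℕ∞) : WithTop ℕ∞) F → HasCompactSupport F →
            Tendsto (fun δ : ℝ => ((∫ x, F x ∂(μ N (T + δ / 2) (T - δ / 2))) -
              ∫ x, F x ∂(μ N T T)) / δ)
              (𝓝[≠] (0 : ℝ)) (𝓝 (∫ x, F x * h x ∂(μ N T T)))) ∧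
          (∀ i : Fin N, Tendsto (fun δ : ℝ =>
              ((∫ x, (pinnedChain ω₂ lam β γ).bondCurrent N i x ∂(μ N (T + δ / 2) (T - δ / 2))) -
                ∫ x, (pinnedChain ω₂ lam β γ).bondCurrent N i x ∂(μ N T T)) / δ)
              (𝓝[≠] (0 : ℝ))
              (𝓝 (∫ x, (pinnedChain ω₂ lam β γ).bondCurrent N i x * h x ∂(μ N T T))))) →
        ∀ η : ℝ, 0 < η → ∀ ε : ℝ, 0 < ε →
          ∀ᶠ δ in 𝓝[≠] (0 : ℝ),
            ∀ φ : PhaseSpace N → ℝ, Measurable φ →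
              μ N (T + δ / 2) (T - δ / 2) =
                ((pinnedChain ω₂ lam β γ).gibbsMeasure N T).withDensity
                  (fun x => ENNReal.ofReal (Real.exp (φ x))) →
              Integrable (fun x => |φ x - φ (x.1, -x.2)| * Real.exp (φ x))
                  ((pinnedChain ω₂ lam β γ).gibbsMeasure N T) ∧
                ∫ x in {x | η < |φ x - φ (x.1, -x.2)|}, |φ x - φ (x.1, -x.2)| * Real.exp (φ x)
                  ∂(pinnedChain ω₂ lam β γ).gibbsMeasure N T ≤ ε * δ ^ 2

/-! ## 2. The junction `K_fix ⟸ A0 ∧ USharp ∧ ΔSharp` -/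

/-- ★★ **THE JUNCTION `K_fix ⟸ A0 ∧ USharp ∧ ΔSharp`.**  Take the A0 exponents `φ_δ` (`|δ| < 2T`);
`μ_T` is a flip-invariant probability measure (`Negative.gibbsMeasure_map_flip`), the states are
`μ_T.tilted φ_δ` (`tilted_of_withDensity_exp`), so USharp — at the item's own `h` — is the
uniform-integrability clause of the seam `klDiv_flip_le_of_uniformlyIntegrable` and ΔSharp its
second-order clause with `D = ½ ∫ (h − h∘Θ)² dμ_{N,T,T}`; the thresholds coincide verbatim.
[folklore] -/
theorem snapshotKLUpperExpansion_of_uniformlyIntegrable (h0 : NessGibbsReweighting)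
    (hu : NessOddLogRatioUniformlyIntegrable) (hΔ : NessFlipTriangularSharp) :
    SnapshotKLUpperExpansion := by
  intro ω₂ lam β γ hω₂ hlam hβ hγ hU μ hμ T hT N hN h hh K hK
  obtain ⟨φ, hφm, hW0⟩ := h0 ω₂ lam β γ hω₂ hlam hβ hγ hU μ hμ T hT N hN
  have huT := hu ω₂ lam β γ hω₂ hlam hβ hγ hU μ hμ T hT N hN h hh
  have hΔh := hΔ ω₂ lam β γ hω₂ hlam hβ hγ hU μ hμ T hT N hN h hh
  set P := pinnedChain ω₂ lam β γ with hP
  set μT := P.gibbsMeasure N T with hμT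
  haveI hprob : IsProbabilityMeasure μT :=
    pinnedChain_isProbabilityMeasure_gibbsMeasure hω₂ hlam.le hβ.le γ N hT
  have hinv : μT.map (fun x : PhaseSpace N => (x.1, -x.2)) = μT := gibbsMeasure_map_flip P N T
  -- the eventual range and the tilted representation of the states
  have h2T : (0 : ℝ) < 2 * T := by positivity
  have hev : ∀ᶠ δ in 𝓝[≠] (0 : ℝ), δ ≠ 0 ∧ |δ| < 2 * T := eventually_ne_and_abs_lt h2T
  have hevT : ∀ᶠ δ in 𝓝[≠] (0 : ℝ), 0 < T + δ / 2 ∧ 0 < T - δ / 2 := eventually_bath_temps_pos hT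
  have hrep : ∀ δ : ℝ, |δ| < 2 * T → 0 < T + δ / 2 → 0 < T - δ / 2 →
      Integrable (fun x => exp (φ δ x)) μT ∧ ∫ x, exp (φ δ x) ∂μT = 1 ∧
        μ N (T + δ / 2) (T - δ / 2) = μT.tilted (φ δ) := by
    intro δ hδa h1' h2'
    haveI : IsProbabilityMeasure (μ N (T + δ / 2) (T - δ / 2)) := (hμ N _ _ h1' h2').1
    exact tilted_of_withDensity_exp (hφm δ) (hW0 δ hδa)
  have hZ : ∀ᶠ δ in 𝓝[≠] (0 : ℝ),
      Integrable (fun x => exp (φ δ x)) μT ∧ ∫ x, exp (φ δ x) ∂μT = 1 := by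
    filter_upwards [hev, hevT] with δ hδ hδT
    exact ⟨(hrep δ hδ.2 hδT.1 hδT.2).1, (hrep δ hδ.2 hδT.1 hδT.2).2.1⟩
  -- (UI) from USharp, at the A0 exponents
  have hUI' : ∀ η : ℝ, 0 < η → ∀ ε : ℝ, 0 < ε → ∀ᶠ δ in 𝓝[≠] (0 : ℝ),
      Integrable (fun x => |φ δ x - φ δ (x.1, -x.2)| * exp (φ δ x)) μT ∧
      ∫ x in {x | η < |φ δ x - φ δ (x.1, -x.2)|}, |φ δ x - φ δ (x.1, -x.2)| * exp (φ δ x) ∂μT ≤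
        ε * δ ^ 2 := by
    intro η hη ε hε
    filter_upwards [huT η hη ε hε, hev] with δ hδu hδ
    exact hδu (φ δ) (hφm δ) (hW0 δ hδ.2)
  -- (ΔSharp) in the seam's form, at the item's own `h`
  set D : ℝ := (1 / 2 : ℝ) * ∫ x, (h x - h (x.1, -x.2)) ^ 2 ∂(μ N T T) with hD
  have hΔ' : ∀ D' : ℝ, D < D' → ∀ᶠ δ in 𝓝[≠] (0 : ℝ),
      ∫ x, (exp (φ δ x) - exp (φ δ (x.1, -x.2))) ^ 2 / (exp (φ δ x) + exp (φ δ (x.1, -x.2))) ∂μT ≤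
        D' * δ ^ 2 := by
    intro D' hD'
    filter_upwards [hΔh D' hD', hev] with δ hδΔ hδ
    exact hδΔ (φ δ) (hφm δ) (hW0 δ hδ.2)
  have hseam := klDiv_flip_le_of_uniformlyIntegrable μT hinv φ hφm hZ hUI' hΔ'
  filter_upwards [hseam K hK, hev, hevT] with δ hs hδ hδT
  rw [(hrep δ hδ.2 hδT.1 hδT.2).2.2]
  exact hs

/-! ## 3. Necessity `K_fix ⟹ USharp` -/

/-- ★★ **NECESSITY `K_fix ⟹ USharp` — no atom.**  At the item's `h`, level `η`, tolerance `ε`,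
put `K₀ = ½ ∫ (h − h∘Θ)² dμ_{N,T,T} ≥ 0` and `θ = excessSlope η · ε > 0`.  `K_fix` at `K₀ + θ`
gives eventually `KL(μ_δ ‖ Θ_*μ_δ) ≤ (K₀ + θ) δ²`; the theorem ΔLower
(`nessFlipTriangularLower_holds`) at `K₀ − θ` gives eventually, for every representing `φ`,
`(K₀ − θ) δ² ≤ Δ`; the one-state excess bound `setIntegral_abs_mul_exp_le_of_klDiv_le` turns the
two into `∫_{|ψ|>η} |ψ| e^{φ} dμ_T ≤ ε δ²`. [folklore] -/
theorem nessOddLogRatioUniformlyIntegrable_of_snapshotKLUpperExpansion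
    (hK : SnapshotKLUpperExpansion) : NessOddLogRatioUniformlyIntegrable := by
  intro ω₂ lam β γ hω₂ hlam hβ hγ hU μ hμ T hT N hN h hh η hη ε hε
  set P := pinnedChain ω₂ lam β γ with hP
  set μT := P.gibbsMeasure N T with hμT
  haveI hprob : IsProbabilityMeasure μT :=
    pinnedChain_isProbabilityMeasure_gibbsMeasure hω₂ hlam.le hβ.le γ N hT
  have hinv : μT.map (fun x : PhaseSpace N => (x.1, -x.2)) = μT := gibbsMeasure_map_flip P N T
  set K₀ : ℝ := (1 / 2 : ℝ) * ∫ x, (h x - h (x.1, -x.2)) ^ 2 ∂(μ N T T) with hK₀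
  have hK₀0 : 0 ≤ K₀ := mul_nonneg (by norm_num) (integral_nonneg fun x => sq_nonneg _)
  have hθ : 0 < excessSlope η * ε := mul_pos (excessSlope_pos hη) hε
  have hev := hK ω₂ lam β γ hω₂ hlam hβ hγ hU μ hμ T hT N hN h hh (K₀ + excessSlope η * ε)
    (by linarith)
  have hlow := nessFlipTriangularLower_holds ω₂ lam β γ hω₂ hlam hβ hγ hU μ hμ T hT N hN h hh
    (K₀ - excessSlope η * ε) (by linarith)
  filter_upwards [hev, hlow, eventually_bath_temps_pos hT] with δ hδ hlowδ hδT φ hφm hrep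
  haveI : IsProbabilityMeasure (μ N (T + δ / 2) (T - δ / 2)) := (hμ N _ _ hδT.1 hδT.2).1
  obtain ⟨hi, hz1, htilt⟩ := tilted_of_withDensity_exp hφm hrep
  have hlow' := hlowδ φ hφm hrep
  rw [htilt] at hδ
  exact setIntegral_abs_mul_exp_le_of_klDiv_le μT hinv hφm hi hz1 hη hε hK₀0 (sq_nonneg δ) hδ hlow'

/-! ## 4. `K_fix ⟺ ΔSharp ∧ USharp` -/

/-- ★★★ **`A0 ⊢ (K_fix ⟺ ΔSharp ∧ USharp)`.**  The fixed-`N` half of the crux is EXACTLY the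
conjunction of the sharp bulk atom (triangular discrimination `≤ K δ²`, generation 89) and the
sharp tail atom (uniform integrability of the odd log-ratio at scale `δ²`); both are necessary
outright, and together with the tree theorem A0 they are sufficient.  [folklore] -/
theorem snapshotKLUpperExpansion_iff (h0 : NessGibbsReweighting) :
    SnapshotKLUpperExpansion ↔ NessFlipTriangularSharp ∧ NessOddLogRatioUniformlyIntegrable :=
  ⟨fun hK => ⟨nessFlipTriangularSharp_of_snapshotKLUpperExpansion hK,
    nessOddLogRatioUniformlyIntegrable_of_snapshotKLUpperExpansion hK⟩,
    fun h => snapshotKLUpperExpansion_of_uniformlyIntegrable h0 h.2 h.1⟩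

/-- **The two halves of the sharp triangular asymptotics.**  Under `K_fix` (hence under ΔSharp,
which `K_fix` implies) and always by ΔLower: for `K' < ½ ∫ (h − h∘Θ)² dμ_{N,T,T} < K`, eventually
in `δ ≠ 0`, every representing `φ` has `K' δ² ≤ Δ ≤ K δ²` — the triangular discrimination of the
pair `(μ_δ, Θ_*μ_δ)` is `½ ∫ (h − h∘Θ)² · δ² (1 + o(1))`. [folklore] -/
theorem nessFlipTriangular_two_sided (hΔ : NessFlipTriangularSharp) :
    ∀ ω₂ lam β γ : ℝ, 0 < ω₂ → 0 < lam → 0 < β → 0 < γ →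
    ∀ hU : (∀ (N : ℕ) (T_L T_R : ℝ), 0 < T_L → 0 < T_R → ∀ μ ν : Measure (PhaseSpace N),
      (pinnedChain ω₂ lam β γ).IsSteadyState N T_L T_R μ →
      (pinnedChain ω₂ lam β γ).IsSteadyState N T_L T_R ν → μ = ν),
    ∀ μ : (N : ℕ) → ℝ → ℝ → Measure (PhaseSpace N),
    ∀ hμ : (∀ (N : ℕ) (T_L T_R : ℝ), 0 < T_L → 0 < T_R →
        (pinnedChain ω₂ lam β γ).IsSteadyState N T_L T_R (μ N T_L T_R)),
      ∀ T : ℝ, 0 < T → ∀ N : ℕ, 2 ≤ N → ∀ h : PhaseSpace N → ℝ,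
        (MemLp h 2 (μ N T T) ∧
          (∀ F : PhaseSpace N → ℝ, ContDiff ℝ ((⊤ : ℕ∞) : WithTop ℕ∞) F → HasCompactSupport F →
            Tendsto (fun δ : ℝ => ((∫ x, F x ∂(μ N (T + δ / 2) (T - δ / 2))) -
              ∫ x, F x ∂(μ N T T)) / δ)
              (𝓝[≠] (0 : ℝ)) (𝓝 (∫ x, F x * h x ∂(μ N T T)))) ∧
          (∀ i : Fin N, Tendsto (fun δ : ℝ =>
              ((∫ x, (pinnedChain ω₂ lam β γ).bondCurrent N i x ∂(μ N (T + δ / 2) (T - δ / 2))) -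
                ∫ x, (pinnedChain ω₂ lam β γ).bondCurrent N i x ∂(μ N T T)) / δ)
              (𝓝[≠] (0 : ℝ))
              (𝓝 (∫ x, (pinnedChain ω₂ lam β γ).bondCurrent N i x * h x ∂(μ N T T))))) →
        ∀ K' K : ℝ, K' < (1 / 2 : ℝ) * ∫ x, (h x - h (x.1, -x.2)) ^ 2 ∂(μ N T T) →
          (1 / 2 : ℝ) * ∫ x, (h x - h (x.1, -x.2)) ^ 2 ∂(μ N T T) < K →
          ∀ᶠ δ in 𝓝[≠] (0 : ℝ),
            ∀ φ : PhaseSpace N → ℝ, Measurable φ →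
              μ N (T + δ / 2) (T - δ / 2) =
                ((pinnedChain ω₂ lam β γ).gibbsMeasure N T).withDensity
                  (fun x => ENNReal.ofReal (Real.exp (φ x))) →
              K' * δ ^ 2 ≤ ∫ x, (Real.exp (φ x) - Real.exp (φ (x.1, -x.2))) ^ 2 /
                  (Real.exp (φ x) + Real.exp (φ (x.1, -x.2)))
                ∂(pinnedChain ω₂ lam β γ).gibbsMeasure N T ∧
              ∫ x, (Real.exp (φ x) - Real.exp (φ (x.1, -x.2))) ^ 2 /
                  (Real.exp (φ x) + Real.exp (φ (x.1, -x.2)))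
                ∂(pinnedChain ω₂ lam β γ).gibbsMeasure N T ≤ K * δ ^ 2 := by
  intro ω₂ lam β γ hω₂ hlam hβ hγ hU μ hμ T hT N hN h hh K' K hK' hK
  filter_upwards [nessFlipTriangularLower_holds ω₂ lam β γ hω₂ hlam hβ hγ hU μ hμ T hT N hN h hh
    K' hK', hΔ ω₂ lam β γ hω₂ hlam hβ hγ hU μ hμ T hT N hN h hh K hK] with δ h1 h2 φ hφm hrep
  exact ⟨h1 φ hφm hrep, h2 φ hφm hrep⟩

end Summit.AtomisticToContinuum.FouriersLaw.Theorems.ExtensiveSnapshotIrreversibility.EnergyWindow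

end
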